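import Mathlib
import Summits.Ventures.DiscreteObjects.Mahler.CensusKernelDeg18P001
import Summits.Ventures.DiscreteObjects.Mahler.CensusKernelDeg18P002
import Summits.Ventures.DiscreteObjects.Mahler.CensusKernelDeg18P003
import Summits.Ventures.DiscreteObjects.Mahler.CensusKernelDeg18P004
import Summits.Ventures.DiscreteObjects.Mahler.CensusKernelDeg18P005
import Summits.Ventures.DiscreteObjects.Mahler.CensusKernelDeg18P006
import Summits.Ventures.DiscreteObjects.Mahler.CensusKernelDeg18P007
import Summits.Ventures.DiscreteObjects.Mahler.CensusKernelDeg18P008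
import Summits.Ventures.DiscreteObjects.Mahler.CensusKernelDeg18P009
import Summits.Ventures.DiscreteObjects.Mahler.CensusKernelDeg18P010
import Summits.Ventures.DiscreteObjects.Mahler.CensusKernelDeg18P011
import Summits.Ventures.DiscreteObjects.Mahler.CensusKernelDeg18P012
import Summits.Ventures.DiscreteObjects.Mahler.CensusKernelDeg18P013
import Summits.Ventures.DiscreteObjects.Mahler.CensusKernelDeg18P014
import Summits.Ventures.DiscreteObjects.Mahler.CensusKernelDeg18P015
import Summits.Ventures.DiscreteObjects.Mahler.CensusKernelDeg18P016
import Summits.Ventures.DiscreteObjects.Mahler.CensusKernelDeg18P017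
import Summits.Ventures.DiscreteObjects.Mahler.CensusKernelDeg18P018
import Summits.Ventures.DiscreteObjects.Mahler.CensusKernelDeg18P019
import Summits.Ventures.DiscreteObjects.Mahler.CensusKernelDeg18P020
import Summits.Ventures.DiscreteObjects.Mahler.CensusKernelDeg18P021
import Summits.Ventures.DiscreteObjects.Mahler.CensusKernelDeg18P022
import Summits.Ventures.DiscreteObjects.Mahler.CensusKernelDeg18P023
import Summits.Ventures.DiscreteObjects.Mahler.CensusKernelDeg18P024
import Summits.Ventures.DiscreteObjects.Mahler.CensusKernelDeg18P025
import Summits.Ventures.DiscreteObjects.Mahler.CensusKernelDeg18P026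
import Summits.Ventures.DiscreteObjects.Mahler.CensusKernelDeg18P027
import Summits.Ventures.DiscreteObjects.Mahler.CensusKernelDeg18P028
import Summits.Ventures.DiscreteObjects.Mahler.CensusKernelDeg18P029
import Summits.Ventures.DiscreteObjects.Mahler.CensusKernelDeg18P030
import Summits.Ventures.DiscreteObjects.Mahler.CensusKernelDeg18P031
import Summits.Ventures.DiscreteObjects.Mahler.CensusKernelDeg18P032
import Summits.Ventures.DiscreteObjects.Mahler.CensusKernelDeg18P033
import Summits.Ventures.DiscreteObjects.Mahler.CensusKernelDeg18P034
import Summits.Ventures.DiscreteObjects.Mahler.CensusKernelDeg18P035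
import Summits.Ventures.DiscreteObjects.Mahler.CensusKernelDeg18P036
import Summits.Ventures.DiscreteObjects.Mahler.CensusKernelDeg18P037
import Summits.Ventures.DiscreteObjects.Mahler.CensusKernelDeg18P038
import Summits.Ventures.DiscreteObjects.Mahler.CensusKernelDeg18P039
import Summits.Ventures.DiscreteObjects.Mahler.CensusKernelDeg18P040
import Summits.Ventures.DiscreteObjects.Mahler.CensusKernelDeg18P041
import Summits.Ventures.DiscreteObjects.Mahler.CensusKernelDeg18P042
import Summits.Ventures.DiscreteObjects.Mahler.CensusKernelDeg18P043

/-!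
# Kernel census, degree 18 (part C1): collector: imports the chunk parts P001…P043 and holds the node lemma of `(2, 4)` (whose sub-node checks live in P042/P043)

Cell `pub-namedobj`, seat `pub-namedobj-mahler-g15`. Framing: lottery ticket; floor = certified bounds/negative ranges.

Part of the kernel proof of `DegreeCensus 18 (13/10) coresDeg18` (see part A for the method: census search with
Toeplitz/resultant cuts and kernel-certified explicit-auxiliary-function cuts; 143637 leaves with `c_1 >= 0`,
32290 certified survivors). This part holds, for the search nodes listed below, one kernel check each (`decide` with
kernel reduction, standard axioms; nodes costing more than the per-theorem budget are split by the next coefficient and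
re-assembled by a node lemma). CONTROL/replication of the published degree-18 list (Boyd 1980; Mossinghoff 1998;
Mossinghoff-Rhin-Wu 2008), not new ground.
-/

namespace Summit.Ventures.DiscreteObjects.Mahler

open Polynomial

/-- Every survivor below the node `[2, 4]` carries a valid certificate (by cases on the next coefficient). -/
theorem certified18n_p2_p4 : ∀ a ∈ censusSearchC T18 CT18 7 [2, 4] (psumsRev [2, 4] 2),
    ∃ c, checkCert 13 10 18 coresDeg18 (1 :: palC a) c = true := by
  intro a ha
  rw [mem_censusSearchC_node_iff (pre := [2, 4]) (n := 2) rfl, (by decide +kernel : nodeLoC T18 CT18 [2, 4] (psumsRev [2, 4] 2) = 4), (by decide +kernel : nodeHiC T18 CT18 [2, 4] (psumsRev [2, 4] 2) = 7)] at ha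
  obtain ⟨ak, hak, ha⟩ := ha
  simp only [List.cons_append, List.nil_append, Nat.reduceAdd] at ha
  rw [mem_icc] at hak
  obtain ⟨hlo, hhi⟩ := hak
  interval_cases ak
  · exact certified18n_p2_p4_p4 a ha
  · exact certified18n_p2_p4_p5 a ha
  · exact certified18n_p2_p4_p6 a ha
  · exact certified18n_p2_p4_p7 a ha


end Summit.Ventures.DiscreteObjects.Mahler
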